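import Literature.AlgebraicGeometry.Modules.PullbackDual
import Literature.AlgebraicGeometry.HodgeTheory.HomComplexPullback
import HarnessLib

/-!
# Naturality of `f^*(E^∨) ≅ (f^*E)^∨` and `f^*(E ⊗ G) ≅ f^*E ⊗ f^*G` in `E`

Layer `Literature/AlgebraicGeometry/Modules`; sequel to `PullbackDual.lean` (`pullbackDualComparison f E : f^*(E^∨) ⟶ (f^*E)^∨`,
`pullbackTwistComparison f hE G : f^* 𝓗om(E^∨, G) ⟶ 𝓗om((f^*E)^∨, f^*G)`, natural in `G`). Here the naturality in the FIRST variable `E`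
(contravariant twice = covariant for the twist), needed to make the twist comparison a morphism of COMPLEXES `f^*•(K• ⊗ G) ⟶ f^*•K• ⊗ f^*G`
(termwise `pullbackTwistComparison`, compatible with the differentials):

* `pullbackDualComparison_naturality` — for `φ : E₁ ⟶ E₂`: `f^*(φ^∨) ≫ d_{E₁} = d_{E₂} ≫ (f^*φ)^∨` (`φ^∨ = sheafHomMapLeft φ 𝒪`);
* `pullbackDualIso_inv_naturality` — the same for the inverses when `E₁`, `E₂` are finite locally free;
* **`pullbackTwistComparison_naturality_left`** — `f^*(φ ⊗ 1_G) ≫ t_{E₂} = t_{E₁} ≫ (f^*φ ⊗ 1_{f^*G})` in the tree's model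
  (`φ ⊗ 1_G = sheafHomMapLeft (sheafHomMapLeft φ 𝒪) G = twistMap φ G` of `HodgeTheory/HigherSigmaOfIso`, definitionally).

Everything is proved from the contravariant naturality of the base-change morphism of the internal Hom
(`HodgeTheory/HomComplexPullback.pullback_map_sheafHomMapLeft_comp_sheafHomPullbackComparison`) and the exchange law
`sheafHomMapLeft_sheafHomMap`; no named facts. Motivation: the complex-level assembly of step (Q5) of the library item (L2)
`SigmaPullbackCompat` (crux stmt-HodgeConjecture-26512); nothing of that crux is asserted here.

## References

* R. Hartshorne, *Algebraic Geometry*, GTM 52 (1977), II Ex. 5.1 (b), (d). [Hartshorne1977]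
* U. Görtz, T. Wedhorn, *Algebraic Geometry I*, 2nd ed. (2020), (7.8.3) and Exercise 7.20 (a). [GortzWedhorn2020]
* The Stacks Project, Tag 01CM (functoriality of the internal Hom). [StacksProject]
-/

noncomputable section

-- `TopCat.Presheaf`/`Scheme.Modules` are not reducible (as in Mathlib's `AlgebraicGeometry/Modules/Sheaf.lean`).
set_option backward.isDefEq.respectTransparency false

open CategoryTheory AlgebraicGeometry Opposite TopologicalSpace Limits

universe u

namespace Literature.AlgebraicGeometry.Modules

open Literature.AlgebraicGeometry.Motives Literature.AlgebraicGeometry.HodgeTheory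

variable {X Y : Scheme.{u}} (f : X ⟶ Y) {E₁ E₂ : Y.Modules} (φ : E₁ ⟶ E₂)

/-- **Naturality of `f^*(E^∨) ⟶ (f^*E)^∨` in `E`**: `f^*(φ^∨) ≫ d_{E₁} = d_{E₂} ≫ (f^*φ)^∨`.
[cite: StacksProject, Tag 01CM] [cite: Hartshorne1977, II Ex. 5.1 (b) and (d)] -/
theorem pullbackDualComparison_naturality :
    (Scheme.Modules.pullback f).map (sheafHomMapLeft φ (unitModule Y)) ≫ pullbackDualComparison f E₁ =
      pullbackDualComparison f E₂ ≫ sheafHomMapLeft ((Scheme.Modules.pullback f).map φ) (unitModule X) := by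
  rw [pullbackDualComparison, pullbackDualComparison, ← Category.assoc,
    pullback_map_sheafHomMapLeft_comp_sheafHomPullbackComparison, Category.assoc, Category.assoc, sheafHomMapLeft_sheafHomMap]

/-- The same for the inverses of the isomorphisms (`E₁`, `E₂` finite locally free): `(d_{E₂})⁻¹ ≫ f^*(φ^∨) = (f^*φ)^∨ ≫ (d_{E₁})⁻¹`.
[cite: Hartshorne1977, II Ex. 5.1 (b) and (d)] -/
theorem pullbackDualIso_inv_naturality (hE₁ : IsFiniteLocallyFree E₁) (hE₂ : IsFiniteLocallyFree E₂) :
    (pullbackDualIso f hE₂).inv ≫ (Scheme.Modules.pullback f).map (sheafHomMapLeft φ (unitModule Y)) =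
      sheafHomMapLeft ((Scheme.Modules.pullback f).map φ) (unitModule X) ≫ (pullbackDualIso f hE₁).inv := by
  rw [Iso.inv_comp_eq, ← Category.assoc, Iso.eq_comp_inv, pullbackDualIso_hom, pullbackDualIso_hom]
  exact pullbackDualComparison_naturality f φ

/-- **Naturality of the twist comparison in `E`**: for `φ : E₁ ⟶ E₂` between finite locally free modules,
`f^*(φ ⊗ 1_G) ≫ t_{E₂} = t_{E₁} ≫ (f^*φ ⊗ 1_{f^*G})`, where `φ ⊗ 1_G = 𝓗om(φ^∨, G)` in the model `E ⊗ G = 𝓗om(E^∨, G)`.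
[cite: StacksProject, Tag 01CM] [cite: Hartshorne1977, II Ex. 5.1 (b) and (d)] -/
theorem pullbackTwistComparison_naturality_left (hE₁ : IsFiniteLocallyFree E₁) (hE₂ : IsFiniteLocallyFree E₂) (G : Y.Modules) :
    (Scheme.Modules.pullback f).map (sheafHomMapLeft (sheafHomMapLeft φ (unitModule Y)) G) ≫ pullbackTwistComparison f hE₂ G =
      pullbackTwistComparison f hE₁ G ≫
        sheafHomMapLeft (sheafHomMapLeft ((Scheme.Modules.pullback f).map φ) (unitModule X)) ((Scheme.Modules.pullback f).obj G) := by
  rw [pullbackTwistComparison, pullbackTwistComparison, ← Category.assoc,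
    pullback_map_sheafHomMapLeft_comp_sheafHomPullbackComparison, Category.assoc, Category.assoc, ← sheafHomMapLeft_comp,
    ← sheafHomMapLeft_comp, pullbackDualIso_inv_naturality f φ hE₁ hE₂]

end Literature.AlgebraicGeometry.Modules

end
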